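import Literature.NumberTheory.Automorphic.ArchEndoscopicChartOrbUnfoldWallPlaces      -- ★ p850894 (this seat): (α4¹) `integrable_unfoldIntegrand`; brings ★ (α1) p850744 per-place leaves
import Literature.NumberTheory.Rogawski1990.ArchBouazizStableFamilySlabSmooth         -- ★ p850541 (this seat): `contDiffOn_leafIntegral_inRegS`, factor lemmas; brings ★ `stOrbFamH`, ★ `stOrbFamH_eq_of_tendsto`, ★ `mem_closure_regS`
import HarnessLib

/-!
# THE SMOOTH MODEL OF THE STABLE ORBITAL FAMILY ON `InRegS S`, PER-PLACE LEAVES: `stOrbFamH L νH fH S = K₀ · E_S · Σ_T I ∘ flipSet T` with `I(c) = ∫ fH(…) d(⊗_w Λ_w)` smooth on `InRegS S`,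
# and the Fubini form of `I` with any set of compact places integrated out first (stage (α4-S7-model) of `ALPHA4-DESIGN.v1.md`; Varadarajan 1989 §6.4, Shelstad 1979 §4, Bouaziz 1994 §3.1)

Topic `NumberTheory/Rogawski1990`; namespace `Literature.NumberTheory.Rogawski1990`.  THEOREMS ONLY (no `def`, no instance, no axiom, no `sorry`).  Cell `pub/hodgecm-mathlib`,
crux H413 (`stmt-HodgeConjecture-24833`), line LH3 (closer stub `stub_N9`, DIRECT ROAD), organ O-L3′ conjunct (ii) pay-down for GENERAL `fH` (LH3-plan (g3) RULINGS #7 (d) ∕ #11).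
Author LH3-p01 (g4).  Count-neutral.

WHY.  The `h2` bound is about `stOrbFamH` on `K ∩ InRegS S`; the engines (★ (α2), ★ (α4-S3)) act on the MODEL `G = K₀ · E_S · Σ_T I ∘ flipSet T`, `I(c) = ∫ fH(eA⁻¹(z_{w,1} γ_w(c_w) z_{w,2} z_{w,1}⁻¹)_w,
b(c)) d(⊗_w Λ_w)(z)` built on the per-place leaves of ★ (α1).  This file packages, for ONE choice of the leaves, everything the assembly consumes:
* §1 **`integral_unfoldIntegrand_eq_integral_integral`** — the Fubini form of `I(c)` with the places `p ⊆ Sᶜ` integrated out first, for GIVEN leaves (explicit at `p`, proper at `c`),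
  at every `c` regular at the compact places (the step of ★ (α4¹), made reusable);
* §2 **`contDiffOn_piLeafIntegral_inRegS`** — `I` is `C^∞` on `InRegS S` (transport of ★ `contDiffOn_leafIntegral_inRegS` along `z ↦ (eA⁻¹ z_{·,1}, eA⁻¹ z_{·,2})`: the image measure is
  finite on compacta, carried by the closed image leaf, uniformly proper);
* §3 **`exists_placeLeaves_stOrbFamH_model`** — THE PACKAGE: `ν_w, K₀, Λ_w, Z_w` with ★ (α1)'s clauses, `R_S · chartOrbH = K₀ · E_S · I` on `RegS S`, `I ∈ C^∞(InRegS S)`,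
  **`stOrbFamH L νH fH S c = K₀ · E_S(c) · Σ_{T ⊆ Sᶜ} I(flipSet T c)` for every `c ∈ InRegS S`** (on `RegS S` by the literal reading and the cancellation of the compact factors; at the real
  walls by ★ `stOrbFamH_eq_of_tendsto` and continuity of the model), and the Fubini form of `I` on `InRegS S` for every `p ⊆ Sᶜ`.
HONEST LABEL: HC_CM is proved only modulo the 7 printed citations (2 remaining: hLiu418 = stmt-HodgeConjecture-24832, h413 = stmt-HodgeConjecture-24833) until rung 0 closes;
bookkeeping for the all-orders transport, pays nothing by itself.

## References
* [Varadarajan1989] V. S. Varadarajan, *An Introduction to Harmonic Analysis on Semisimple Lie Groups*, Cambridge Stud. Adv. Math. 16 (1989), §6.4 Lemma 21, Thm 23.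
* [Shelstad1979] D. Shelstad, *Characters and inner forms of a quasi-split group over ℝ*, Compositio Math. 39 (1979), §4 pp. 22–25.
* [Bouaziz1994IntegralesOrbitales] A. Bouaziz, *Intégrales orbitales sur les algèbres de Lie réductives*, Invent. Math. 115 (1994), §3.1 p. 579; §6.2 p. 591.
* [Folland1995] G. B. Folland, *A Course in Abstract Harmonic Analysis* (1995), §2.6 (2.52).
* [Rogawski1990] J. D. Rogawski, *Automorphic Representations of Unitary Groups in Three Variables*, Ann. of Math. Stud. 123 (1990), §4.1 p. 39; §8.2 pp. 119–122.
-/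

set_option autoImplicit false

noncomputable section

open MeasureTheory Measure Filter Topology Set Function NumberField NumberField.InfinitePlace Matrix Complex
open Literature.NumberTheory.Automorphic Literature.NumberTheory.Automorphic.UnitaryGroup Literature.NumberTheory.Automorphic.ArchCartan
open scoped ContDiff Classical MatrixGroups Matrix ENNReal NNReal

namespace Literature.NumberTheory.Rogawski1990

local notation3 "Φ₂[" L "]" => (Matrix.of fun i j : Fin 2 => if i.val + j.val + 1 = 2 then (1 : L) else 0)
local notation3 "Φ₁[" L "]" => (Matrix.of fun i j : Fin 1 => if i.val + j.val + 1 = 1 then (1 : L) else 0)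
local notation3 "𝔸[" L "]" => ↥(arch (↥(maximalRealSubfield L)) L (IsCMField.complexConj L) 2 Φ₂[L])
local notation3 "𝔹[" L "]" => ↥(arch (↥(maximalRealSubfield L)) L (IsCMField.complexConj L) 1 Φ₁[L])

/-! ## §1 The Fubini form of the pi-leaf integral for given leaves -/

section Fubini

variable (L : Type) [Field L] [NumberField L] [IsCMField L] (S : Finset {w : InfinitePlace L // IsComplex w})
  [∀ w : {w : InfinitePlace L // IsComplex w}, MeasurableSpace ↥(archLocal L 2 Φ₂[L] w)]
  [∀ w : {w : InfinitePlace L // IsComplex w}, BorelSpace ↥(archLocal L 2 Φ₂[L] w)]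

/-- **FUBINI FORM OF THE PI-LEAF INTEGRAL, GIVEN THE LEAVES**: for continuous compactly supported `fH`, leaves `Λ_w` (finite on compacta, σ-finite) carried by closed `Z_w`, EXPLICIT
(`Λ_w = (g ↦ (g,1))_* ν_w`) at the places `p`, and proper at the point `c`, `∫ fH(…) d(⊗_w Λ_w) = ∫_{z' ∈ Π_{¬p}} ( ∫_{g ∈ Π_p G_w} fH(eA⁻¹ (w ↦ [p w ? g_w γ_w g_w⁻¹ : z'_{w,1} γ_w z'_{w,2} z'_{w,1}⁻¹]), b) d(⊗_p ν_w) ) d(⊗_{¬p} Λ_w)`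
(Mathlib `measurePreserving_piEquivPiSubtypeProd`, `integral_prod_symm`, `Measure.pi_map_pi`). [cite: Folland1995, §2.6 (2.52)] [cite: Varadarajan1989, §6.4 Lemma 21] -/
theorem integral_unfoldIntegrand_eq_integral_integral (fH : 𝔸[L] × 𝔹[L] → ℂ) (hf : Continuous fH) (hfc : HasCompactSupport fH)
    (Λw : ∀ w : {w : InfinitePlace L // IsComplex w}, Measure (↥(archLocal L 2 Φ₂[L] w) × ↥(archLocal L 2 Φ₂[L] w))) [∀ w, IsFiniteMeasureOnCompacts (Λw w)]
    [∀ w, SigmaFinite (Λw w)]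
    (Zw : ∀ w : {w : InfinitePlace L // IsComplex w}, Set (↥(archLocal L 2 Φ₂[L] w) × ↥(archLocal L 2 Φ₂[L] w))) (hZcl : ∀ w, IsClosed (Zw w)) (hZnull : ∀ w, Λw w (Zw w)ᶜ = 0)
    (νw : ∀ w : {w : InfinitePlace L // IsComplex w}, Measure ↥(archLocal L 2 Φ₂[L] w)) [∀ w, SigmaFinite (νw w)]
    (p : {w : InfinitePlace L // IsComplex w} → Prop) [DecidablePred p]
    (hexpl : ∀ w, p w → Λw w = Measure.map (fun g : ↥(archLocal L 2 Φ₂[L] w) => (g, (1 : ↥(archLocal L 2 Φ₂[L] w)))) (νw w))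
    (c : {w : InfinitePlace L // IsComplex w} → Fin 3 → ℝ)
    (hprop : ∀ (w) (C' : Set ↥(archLocal L 2 Φ₂[L] w)), IsCompact C' → ∃ 𝒮 : Set (↥(archLocal L 2 Φ₂[L] w) × ↥(archLocal L 2 Φ₂[L] w)), IsCompact 𝒮 ∧
      ∀ z ∈ Zw w, z.1 * (endoBlockAt L S w (c w) * z.2) * z.1⁻¹ ∈ C' → z ∈ 𝒮)
    (b : 𝔹[L]) :
    (∫ z : ∀ w : {w : InfinitePlace L // IsComplex w}, ↥(archLocal L 2 Φ₂[L] w) × ↥(archLocal L 2 Φ₂[L] w),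
      fH ((archPiEquivCM 2 L Φ₂[L]).symm (fun w => (z w).1 * (endoBlockAt L S w (c w) * (z w).2) * (z w).1⁻¹), b) ∂(Measure.pi Λw)) =
      ∫ z' : ∀ w : {w : {w : InfinitePlace L // IsComplex w} // ¬ p w}, ↥(archLocal L 2 Φ₂[L] w.1) × ↥(archLocal L 2 Φ₂[L] w.1),
        (∫ g : ∀ w : {w : {w : InfinitePlace L // IsComplex w} // p w}, ↥(archLocal L 2 Φ₂[L] w.1),
          fH ((archPiEquivCM 2 L Φ₂[L]).symm (fun w => if h : p w then g ⟨w, h⟩ * endoBlockAt L S w (c w) * (g ⟨w, h⟩)⁻¹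
            else (z' ⟨w, h⟩).1 * (endoBlockAt L S w (c w) * (z' ⟨w, h⟩).2) * (z' ⟨w, h⟩).1⁻¹), b)
          ∂(Measure.pi fun w : {w : {w : InfinitePlace L // IsComplex w} // p w} => νw w.1))
        ∂(Measure.pi fun w : {w : {w : InfinitePlace L // IsComplex w} // ¬ p w} => Λw w.1) := by
  haveI : ∀ w : {w : InfinitePlace L // IsComplex w}, LocallyCompactSpace ↥(archLocal L 2 Φ₂[L] w) := fun w => locallyCompactSpace_archLocal_two L w
  haveI : ∀ w : {w : InfinitePlace L // IsComplex w}, SecondCountableTopology ↥(archLocal L 2 Φ₂[L] w) := fun w => secondCountableTopology_archLocal_two L w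
  -- abbreviations: the integrand `Ψ` (generalised), the splitting equivalence `e`
  obtain ⟨Ψ, hΨ_def⟩ : ∃ Ψ : (∀ w : {w : InfinitePlace L // IsComplex w}, ↥(archLocal L 2 Φ₂[L] w) × ↥(archLocal L 2 Φ₂[L] w)) → ℂ,
      Ψ = fun z => fH ((archPiEquivCM 2 L Φ₂[L]).symm (fun w => (z w).1 * (endoBlockAt L S w (c w) * (z w).2) * (z w).1⁻¹), b) := ⟨_, rfl⟩
  have hLHS : (∫ z, fH ((archPiEquivCM 2 L Φ₂[L]).symm (fun w => (z w).1 * (endoBlockAt L S w (c w) * (z w).2) * (z w).1⁻¹), b) ∂(Measure.pi Λw)) =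
      ∫ z, Ψ z ∂(Measure.pi Λw) := by rw [hΨ_def]
  rw [hLHS]
  let e := MeasurableEquiv.piEquivPiSubtypeProd (fun w : {w : InfinitePlace L // IsComplex w} => ↥(archLocal L 2 Φ₂[L] w) × ↥(archLocal L 2 Φ₂[L] w)) p
  -- (1) integrability (properness at the point `c`)
  have hint : Integrable Ψ (Measure.pi Λw) := by
    rw [hΨ_def]
    exact integrable_unfoldIntegrand L S fH hf hfc Λw Zw hZcl hZnull c hprop b
  -- (2) split the product of the leaves and apply Fubini
  have hmp : MeasurePreserving e (Measure.pi Λw) ((Measure.pi fun w : {w // p w} => Λw w.1).prod (Measure.pi fun w : {w // ¬ p w} => Λw w.1)) :=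
    measurePreserving_piEquivPiSubtypeProd Λw p
  have hmp' : MeasurePreserving e.symm ((Measure.pi fun w : {w // p w} => Λw w.1).prod (Measure.pi fun w : {w // ¬ p w} => Λw w.1)) (Measure.pi Λw) := hmp.symm e
  have hint' : Integrable (Ψ ∘ e.symm) ((Measure.pi fun w : {w // p w} => Λw w.1).prod (Measure.pi fun w : {w // ¬ p w} => Λw w.1)) :=
    (hmp'.integrable_comp_emb e.symm.measurableEmbedding).2 hint
  rw [← hmp'.integral_comp' Ψ, integral_prod_symm (fun z => Ψ (e.symm z)) hint']
  refine integral_congr_ae (Eventually.of_forall fun z' => ?_)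
  -- (3) the inner integral: the `p`-leaves are the whole groups
  have hι : ∀ w : {w // p w}, Measurable fun g : ↥(archLocal L 2 Φ₂[L] w.1) => (g, (1 : ↥(archLocal L 2 Φ₂[L] w.1))) := fun w => measurable_id.prodMk measurable_const
  haveI : ∀ w : {w // p w}, SigmaFinite ((νw w.1).map fun g : ↥(archLocal L 2 Φ₂[L] w.1) => (g, (1 : ↥(archLocal L 2 Φ₂[L] w.1)))) := fun w => by
    rw [← hexpl w.1 w.2]; infer_instance
  have hpi : (Measure.pi fun w : {w // p w} => Λw w.1) =
      (Measure.pi fun w : {w // p w} => νw w.1).map (fun g w => (g w, (1 : ↥(archLocal L 2 Φ₂[L] w.1)))) := by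
    rw [Measure.pi_map_pi fun w => (hι w).aemeasurable]
    exact congrArg Measure.pi (funext fun w => hexpl w.1 w.2)
  have hΨc : Continuous Ψ := by
    rw [hΨ_def]
    exact hf.comp (((archPiEquivCM 2 L Φ₂[L]).symm.continuous.comp (continuous_pi fun w =>
      ((continuous_fst.mul (continuous_const.mul continuous_snd)).mul continuous_fst.inv).comp (continuous_apply w))).prodMk continuous_const)
  have hΨm : Measurable Ψ := hΨc.measurable
  have hGm : Measurable fun (g : ∀ w : {w // p w}, ↥(archLocal L 2 Φ₂[L] w.1)) (w : {w // p w}) => (g w, (1 : ↥(archLocal L 2 Φ₂[L] w.1))) :=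
    measurable_pi_lambda _ fun w => (hι w).comp (measurable_pi_apply w)
  show ∫ x, (Ψ ∘ e.symm) (x, z') ∂(Measure.pi fun w : {w // p w} => Λw w.1) = _
  rw [hpi]
  have hsm : AEStronglyMeasurable (fun x : ∀ w : {w // p w}, ↥(archLocal L 2 Φ₂[L] w.1) × ↥(archLocal L 2 Φ₂[L] w.1) => (Ψ ∘ e.symm) (x, z'))
      ((Measure.pi fun w : {w // p w} => νw w.1).map (fun g w => (g w, (1 : ↥(archLocal L 2 Φ₂[L] w.1))))) :=
    (hΨm.comp (e.symm.measurable.comp measurable_prodMk_right)).aestronglyMeasurable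
  rw [integral_map hGm.aemeasurable hsm]
  refine integral_congr_ae (Eventually.of_forall fun g => ?_)
  -- (4) pointwise: the split point, the compact leaves at `(g_w, 1)`
  show Ψ (e.symm (fun w : {w // p w} => (g w, (1 : ↥(archLocal L 2 Φ₂[L] w.1))), z')) = _
  rw [hΨ_def]
  refine congrArg (fun F : ∀ w : {w : InfinitePlace L // IsComplex w}, ↥(archLocal L 2 Φ₂[L] w) =>
    fH ((archPiEquivCM 2 L Φ₂[L]).symm F, b)) (funext fun w => ?_)
  have hw : e.symm (fun w : {w // p w} => (g w, (1 : ↥(archLocal L 2 Φ₂[L] w.1))), z') w =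
      (if h : p w then (g ⟨w, h⟩, (1 : ↥(archLocal L 2 Φ₂[L] w))) else z' ⟨w, h⟩) := rfl
  rw [hw]
  by_cases h : p w
  · rw [dif_pos h, dif_pos h, mul_one]
  · rw [dif_neg h, dif_neg h]

end Fubini

/-! ## §2 The pi-leaf integral is `C^∞` on `InRegS S` (transport of ★ `contDiffOn_leafIntegral_inRegS`) -/

section Smooth

variable (L : Type) [Field L] [NumberField L] [IsCMField L] (S : Finset {w : InfinitePlace L // IsComplex w})
  [∀ w : {w : InfinitePlace L // IsComplex w}, MeasurableSpace ↥(archLocal L 2 Φ₂[L] w)]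
  [∀ w : {w : InfinitePlace L // IsComplex w}, BorelSpace ↥(archLocal L 2 Φ₂[L] w)]
  [MeasurableSpace 𝔸[L]] [BorelSpace 𝔸[L]]

/-- **THE PI-LEAF INTEGRAL IS SMOOTH ON `InRegS S`**: for `fH ∈ C_c^∞(H_∞)` and per-place leaves `Λ_w` (finite on compacta, σ-finite, carried by closed `Z_w`, UNIFORMLY PROPER over compacts of
coordinates regular at the compact places — the clauses of ★ (α1)), `c ↦ ∫ fH(eA⁻¹(z_{w,1} γ_w(c_w) z_{w,2} z_{w,1}⁻¹)_w, b(c)) d(⊗_w Λ_w)` is `C^∞` on `InRegS S` — ★ `contDiffOn_leafIntegral_inRegS` for the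
image measure under `z ↦ (eA⁻¹ z_{·,1}, eA⁻¹ z_{·,2})` (finite on compacta, carried by the closed image leaf, uniformly proper). [cite: Varadarajan1989, §6.4 Thm 23]
[cite: Bouaziz1994IntegralesOrbitales, §3.1 p. 579] [cite: Rogawski1990, §8.2 p. 119] -/
theorem contDiffOn_piLeafIntegral_inRegS {fH : 𝔸[L] × 𝔹[L] → ℂ} (hfH : ArchSmooth₂ L fH)
    (Λw : ∀ w : {w : InfinitePlace L // IsComplex w}, Measure (↥(archLocal L 2 Φ₂[L] w) × ↥(archLocal L 2 Φ₂[L] w))) [∀ w, IsFiniteMeasureOnCompacts (Λw w)]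
    [∀ w, SigmaFinite (Λw w)]
    (Zw : ∀ w : {w : InfinitePlace L // IsComplex w}, Set (↥(archLocal L 2 Φ₂[L] w) × ↥(archLocal L 2 Φ₂[L] w))) (hZcl : ∀ w, IsClosed (Zw w)) (hZnull : ∀ w, Λw w (Zw w)ᶜ = 0)
    (hprop : ∀ (w) (U : Set ({w : InfinitePlace L // IsComplex w} → Fin 3 → ℝ)), IsCompact U → (w ∉ S → ∀ c ∈ U, Circle.exp (c w 0) ≠ Circle.exp (c w 2)) →
      ∀ C' : Set ↥(archLocal L 2 Φ₂[L] w), IsCompact C' →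
        ∃ 𝒮 : Set (↥(archLocal L 2 Φ₂[L] w) × ↥(archLocal L 2 Φ₂[L] w)), IsCompact 𝒮 ∧
          ∀ z ∈ Zw w, ∀ c ∈ U, z.1 * (endoBlockAt L S w (c w) * z.2) * z.1⁻¹ ∈ C' → z ∈ 𝒮) :
    ContDiffOn ℝ ∞ (fun c : {w : InfinitePlace L // IsComplex w} → Fin 3 → ℝ =>
      ∫ z : ∀ w : {w : InfinitePlace L // IsComplex w}, ↥(archLocal L 2 Φ₂[L] w) × ↥(archLocal L 2 Φ₂[L] w),
        fH ((archPiEquivCM 2 L Φ₂[L]).symm (fun w => (z w).1 * (endoBlockAt L S w (c w) * (z w).2) * (z w).1⁻¹), (endoTorus L S c).2) ∂(Measure.pi Λw)) (InRegS S) := by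
  haveI : ∀ w : {w : InfinitePlace L // IsComplex w}, LocallyCompactSpace ↥(archLocal L 2 Φ₂[L] w) := fun w => locallyCompactSpace_archLocal_two L w
  haveI : ∀ w : {w : InfinitePlace L // IsComplex w}, SecondCountableTopology ↥(archLocal L 2 Φ₂[L] w) := fun w => secondCountableTopology_archLocal_two L w
  -- the transport `T : Π_w (G_w × G_w) → A × A` and its inverse `Sinv`
  let T : (∀ w : {w : InfinitePlace L // IsComplex w}, ↥(archLocal L 2 Φ₂[L] w) × ↥(archLocal L 2 Φ₂[L] w)) → 𝔸[L] × 𝔸[L] :=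
    fun z => ((archPiEquivCM 2 L Φ₂[L]).symm (fun w => (z w).1), (archPiEquivCM 2 L Φ₂[L]).symm (fun w => (z w).2))
  have hT : Continuous T :=
    ((archPiEquivCM 2 L Φ₂[L]).symm.continuous.comp (continuous_pi fun w => continuous_fst.comp (continuous_apply w))).prodMk
      ((archPiEquivCM 2 L Φ₂[L]).symm.continuous.comp (continuous_pi fun w => continuous_snd.comp (continuous_apply w)))
  let Sinv : 𝔸[L] × 𝔸[L] → (∀ w : {w : InfinitePlace L // IsComplex w}, ↥(archLocal L 2 Φ₂[L] w) × ↥(archLocal L 2 Φ₂[L] w)) :=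
    fun a w => (archPiEquivCM 2 L Φ₂[L] a.1 w, archPiEquivCM 2 L Φ₂[L] a.2 w)
  have hS : Continuous Sinv := continuous_pi fun w =>
    ((continuous_apply w).comp ((archPiEquivCM 2 L Φ₂[L]).continuous.comp continuous_fst)).prodMk
      ((continuous_apply w).comp ((archPiEquivCM 2 L Φ₂[L]).continuous.comp continuous_snd))
  have hST : ∀ z, Sinv (T z) = z := fun z => by
    funext w
    simp only [Sinv, T, ContinuousMulEquiv.apply_symm_apply]
  have hTS : ∀ a, T (Sinv a) = a := fun a => by
    simp only [Sinv, T, ContinuousMulEquiv.symm_apply_apply]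
  -- the chart point: `(endoTorus S c).1 = eA⁻¹ (w ↦ γ_w(c_w))`
  have hγ : ∀ c : {w : InfinitePlace L // IsComplex w} → Fin 3 → ℝ,
      (endoTorus L S c).1 = (archPiEquivCM 2 L Φ₂[L]).symm (fun w => endoBlockAt L S w (c w)) := fun c => by
    rw [ContinuousMulEquiv.eq_symm_apply]
    funext w
    exact archPiEquivCM_endoTorus_fst L S c w
  -- the integrand along `T`
  have hpt : ∀ (z : ∀ w : {w : InfinitePlace L // IsComplex w}, ↥(archLocal L 2 Φ₂[L] w) × ↥(archLocal L 2 Φ₂[L] w)) (c : {w : InfinitePlace L // IsComplex w} → Fin 3 → ℝ),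
      ((archPiEquivCM 2 L Φ₂[L]).symm (fun w => (z w).1 * (endoBlockAt L S w (c w) * (z w).2) * (z w).1⁻¹), (endoTorus L S c).2) =
        ((T z).1, (1 : 𝔹[L])) * (endoTorus L S c * ((T z).2, (1 : 𝔹[L]))) * ((T z).1, (1 : 𝔹[L]))⁻¹ := by
    intro z c
    refine Prod.ext ?_ ?_
    · show (archPiEquivCM 2 L Φ₂[L]).symm ((fun w => (z w).1) * ((fun w => endoBlockAt L S w (c w)) * fun w => (z w).2) * (fun w => (z w).1)⁻¹) =
        (archPiEquivCM 2 L Φ₂[L]).symm (fun w => (z w).1) * ((endoTorus L S c).1 * (archPiEquivCM 2 L Φ₂[L]).symm (fun w => (z w).2)) *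
          ((archPiEquivCM 2 L Φ₂[L]).symm (fun w => (z w).1))⁻¹
      rw [map_mul, map_mul, map_mul, map_inv, hγ]
    · show (endoTorus L S c).2 = 1 * ((endoTorus L S c).2 * 1) * 1⁻¹
      rw [mul_one, one_mul, inv_one, mul_one]
  -- the image measure: finite on compacta, carried by the closed image leaf
  have hpifin : ∀ K : Set (∀ w : {w : InfinitePlace L // IsComplex w}, ↥(archLocal L 2 Φ₂[L] w) × ↥(archLocal L 2 Φ₂[L] w)), IsCompact K → Measure.pi Λw K < ⊤ := by
    intro K hK
    refine (measure_mono (fun z hz => Set.mem_univ_pi.2 fun w => Set.mem_image_of_mem (fun z' => z' w) hz : K ⊆ Set.pi univ fun w => (fun z' => z' w) '' K)).trans_lt ?_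
    rw [Measure.pi_pi]
    exact ENNReal.prod_lt_top fun w _ => (hK.image (continuous_apply w)).measure_lt_top
  haveI : IsFiniteMeasureOnCompacts ((Measure.pi Λw).map T) := by
    refine ⟨fun K hK => ?_⟩
    rw [Measure.map_apply hT.measurable hK.measurableSet]
    exact (measure_mono (show T ⁻¹' K ⊆ Sinv '' K from fun z hz => ⟨T z, hz, hST z⟩)).trans_lt (hpifin _ (hK.image hS))
  have hZ : IsClosed (Sinv ⁻¹' Set.pi univ Zw) := (isClosed_set_pi fun w _ => hZcl w).preimage hS
  have hΛZ : ((Measure.pi Λw).map T) (Sinv ⁻¹' Set.pi univ Zw)ᶜ = 0 := by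
    rw [Measure.map_apply hT.measurable hZ.measurableSet.compl]
    have h1 : T ⁻¹' (Sinv ⁻¹' Set.pi univ Zw)ᶜ ⊆ ⋃ w, {z | z w ∈ (Zw w)ᶜ} := by
      intro z hz
      have hz' : ¬ z ∈ Set.pi univ Zw := by simpa only [Set.mem_preimage, Set.mem_compl_iff, hST z] using hz
      simpa only [Set.mem_univ_pi, not_forall, Set.mem_iUnion, Set.mem_setOf_eq, Set.mem_compl_iff] using hz'
    refine measure_mono_null h1 (measure_iUnion_null fun w => ?_)
    have h2 : {z : ∀ w : {w : InfinitePlace L // IsComplex w}, ↥(archLocal L 2 Φ₂[L] w) × ↥(archLocal L 2 Φ₂[L] w) | z w ∈ (Zw w)ᶜ} ⊆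
        Set.pi univ (Function.update (fun w' => (univ : Set (↥(archLocal L 2 Φ₂[L] w') × ↥(archLocal L 2 Φ₂[L] w')))) w (Zw w)ᶜ) := by
      intro z hz
      refine Set.mem_univ_pi.2 fun w' => ?_
      by_cases h : w' = w
      · subst h; rw [Function.update_self]; exact hz
      · rw [Function.update_of_ne h]; exact Set.mem_univ _
    refine measure_mono_null h2 ?_
    rw [Measure.pi_pi]
    exact Finset.prod_eq_zero (Finset.mem_univ w) (by rw [Function.update_self, hZnull])
  -- uniform properness of the image leaf
  have hprop' : ∀ U : Set ({w : InfinitePlace L // IsComplex w} → Fin 3 → ℝ), IsCompact U → (∀ c ∈ U, ∀ w, w ∉ S → Circle.exp (c w 0) ≠ Circle.exp (c w 2)) →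
      ∀ C : Set (𝔸[L] × 𝔹[L]), IsCompact C → ∃ 𝒮 : Set (𝔸[L] × 𝔸[L]), IsCompact 𝒮 ∧
        ∀ z ∈ Sinv ⁻¹' Set.pi univ Zw, ∀ c ∈ U, ((z.1, (1 : 𝔹[L])) * (endoTorus L S c * (z.2, (1 : 𝔹[L]))) * (z.1, (1 : 𝔹[L]))⁻¹) ∈ C → z ∈ 𝒮 := by
    intro U hU hreg C hC
    have hCw : ∀ w : {w : InfinitePlace L // IsComplex w}, IsCompact ((fun k : 𝔸[L] × 𝔹[L] => archPiEquivCM 2 L Φ₂[L] k.1 w) '' C) :=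
      fun w => hC.image ((continuous_apply w).comp ((archPiEquivCM 2 L Φ₂[L]).continuous.comp continuous_fst))
    choose 𝒮 h𝒮c h𝒮 using fun w => hprop w U hU (fun hw c hc => hreg c hc w hw) _ (hCw w)
    refine ⟨T '' Set.pi univ 𝒮, (isCompact_univ_pi h𝒮c).image hT, fun zt hzt c hc hmem => ?_⟩
    refine ⟨Sinv zt, Set.mem_univ_pi.2 fun w => h𝒮 w (Sinv zt w) (Set.mem_univ_pi.1 hzt w) c hc ⟨_, hmem, ?_⟩, hTS zt⟩
    show archPiEquivCM 2 L Φ₂[L] (zt.1 * ((endoTorus L S c).1 * zt.2) * zt.1⁻¹) w = (Sinv zt w).1 * (endoBlockAt L S w (c w) * (Sinv zt w).2) * (Sinv zt w).1⁻¹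
    rw [map_mul, map_mul, map_mul, map_inv]
    simp only [Pi.mul_apply, Pi.inv_apply, archPiEquivCM_endoTorus_fst, endoBlock_eq_endoBlockAt, Sinv]
  -- the integral in transported form, and ★ `contDiffOn_leafIntegral_inRegS`
  have hmeas : ∀ c : {w : InfinitePlace L // IsComplex w} → Fin 3 → ℝ, AEStronglyMeasurable
      (fun zt : 𝔸[L] × 𝔸[L] => fH ((zt.1, (1 : 𝔹[L])) * (endoTorus L S c * (zt.2, (1 : 𝔹[L]))) * (zt.1, (1 : 𝔹[L]))⁻¹)) ((Measure.pi Λw).map T) := fun c =>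
    (hfH.continuous.comp (((continuous_fst.prodMk continuous_const).mul (continuous_const.mul (continuous_snd.prodMk continuous_const))).mul
      (continuous_fst.prodMk continuous_const).inv)).aestronglyMeasurable
  have hfun : (fun c : {w : InfinitePlace L // IsComplex w} → Fin 3 → ℝ =>
      ∫ z : ∀ w : {w : InfinitePlace L // IsComplex w}, ↥(archLocal L 2 Φ₂[L] w) × ↥(archLocal L 2 Φ₂[L] w),
        fH ((archPiEquivCM 2 L Φ₂[L]).symm (fun w => (z w).1 * (endoBlockAt L S w (c w) * (z w).2) * (z w).1⁻¹), (endoTorus L S c).2) ∂(Measure.pi Λw)) =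
      fun c => ∫ zt, fH ((zt.1, (1 : 𝔹[L])) * (endoTorus L S c * (zt.2, (1 : 𝔹[L]))) * (zt.1, (1 : 𝔹[L]))⁻¹) ∂((Measure.pi Λw).map T) := by
    funext c
    rw [integral_map hT.measurable.aemeasurable (hmeas c)]
    exact integral_congr_ae (Eventually.of_forall fun z => congrArg fH (hpt z c))
  rw [hfun]
  exact contDiffOn_leafIntegral_inRegS L S hfH ((Measure.pi Λw).map T) hZ hΛZ hprop'

end Smooth

/-! ## §3 THE PACKAGE: leaves, the unfolding on `RegS S`, the smooth model of `stOrbFamH` on `InRegS S`, and the Fubini form -/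

section Model

variable (L : Type) [Field L] [NumberField L] [IsCMField L] (S : Finset {w : InfinitePlace L // IsComplex w})
  [∀ w : {w : InfinitePlace L // IsComplex w}, MeasurableSpace ↥(archLocal L 2 Φ₂[L] w)]
  [∀ w : {w : InfinitePlace L // IsComplex w}, BorelSpace ↥(archLocal L 2 Φ₂[L] w)]
  [MeasurableSpace 𝔸[L]] [BorelSpace 𝔸[L]] [MeasurableSpace 𝔹[L]] [BorelSpace 𝔹[L]]
  (νH : Measure (𝔸[L] × 𝔹[L])) [νH.IsHaarMeasure] [νH.IsMulRightInvariant]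

set_option maxHeartbeats 400000 in
/-- **THE SMOOTH MODEL OF THE STABLE ORBITAL FAMILY, PER-PLACE LEAVES.**  For `fH ∈ C_c^∞(H_∞)` (★ `ArchSmooth₂`), a Haar measure `νH` and a Cartan label `S` there are Haar measures `ν_w`
on the `U(Φ₂)_w`, `K₀ : ℝ`, leaves `Λ_w` finite on compacta carried by closed `Z_w` (null complement), explicit at the compact places (`Λ_w = (g ↦ (g,1))_* ν_w`, `w ∉ S`) and uniformly
proper (★ (α1)), such that with `I(c) := ∫ fH(eA⁻¹(z_{w,1} γ_w(c_w) z_{w,2} z_{w,1}⁻¹)_w, b(c)) d(⊗_w Λ_w)` and `E_S(c) = Π_w [w ∈ S ? e^{x_w} : 1 − e^{i(θ_{w,2}−θ_{w,0})}]`: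
(a) `R_S(c) · chartOrbH νH S fH c = K₀ · E_S(c) · I(c)` on `RegS S`; (b) `I ∈ C^∞(InRegS S)`; (c) **`stOrbFamH L νH fH S c = K₀ · E_S(c) · Σ_{T ⊆ Sᶜ} I(flipSet T c)` for EVERY `c ∈ InRegS S`**;
(d) for every set of compact places `p ⊆ Sᶜ` and every `c ∈ InRegS S`, the Fubini form of `I(c)` with the places `p` integrated out first (§1).
[cite: Varadarajan1989, §6.4 Lemma 21, Thm 23] [cite: Shelstad1979, §4 pp. 22–25] [cite: Bouaziz1994IntegralesOrbitales, §3.1 p. 579; §6.2 p. 591] [cite: Rogawski1990, §4.1 (4.1.1) p. 39] -/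
theorem exists_placeLeaves_stOrbFamH_model {fH : 𝔸[L] × 𝔹[L] → ℂ} (hfH : ArchSmooth₂ L fH) :
    ∃ (νw : ∀ w : {w : InfinitePlace L // IsComplex w}, Measure ↥(archLocal L 2 Φ₂[L] w)) (_ : ∀ w, (νw w).IsHaarMeasure) (_ : ∀ w, (νw w).IsMulRightInvariant)
      (K₀ : ℝ) (Λw : ∀ w : {w : InfinitePlace L // IsComplex w}, Measure (↥(archLocal L 2 Φ₂[L] w) × ↥(archLocal L 2 Φ₂[L] w)))
      (Zw : ∀ w : {w : InfinitePlace L // IsComplex w}, Set (↥(archLocal L 2 Φ₂[L] w) × ↥(archLocal L 2 Φ₂[L] w))),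
      (∀ w, IsFiniteMeasureOnCompacts (Λw w)) ∧ (∀ w, SigmaFinite (Λw w)) ∧ (∀ w, IsClosed (Zw w)) ∧ (∀ w, Λw w (Zw w)ᶜ = 0) ∧
      (∀ w, w ∉ S → Λw w = Measure.map (fun g : ↥(archLocal L 2 Φ₂[L] w) => (g, (1 : ↥(archLocal L 2 Φ₂[L] w)))) (νw w)) ∧
      (∀ (w) (U : Set ({w : InfinitePlace L // IsComplex w} → Fin 3 → ℝ)), IsCompact U → (w ∉ S → ∀ c ∈ U, Circle.exp (c w 0) ≠ Circle.exp (c w 2)) →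
        ∀ C' : Set ↥(archLocal L 2 Φ₂[L] w), IsCompact C' →
          ∃ 𝒮 : Set (↥(archLocal L 2 Φ₂[L] w) × ↥(archLocal L 2 Φ₂[L] w)), IsCompact 𝒮 ∧
            ∀ z ∈ Zw w, ∀ c ∈ U, z.1 * (endoBlockAt L S w (c w) * z.2) * z.1⁻¹ ∈ C' → z ∈ 𝒮) ∧
      (∀ c : {w : InfinitePlace L // IsComplex w} → Fin 3 → ℝ, c ∈ RegS S →
        archRH S c * chartOrbH L νH S fH c =
          (K₀ : ℂ) * (∏ w, (if w ∈ S then ((Real.exp (c w 0) : ℝ) : ℂ) else 1 - (Circle.exp (c w 2 - c w 0) : ℂ))) *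
            ∫ z, fH ((archPiEquivCM 2 L Φ₂[L]).symm (fun w => (z w).1 * (endoBlockAt L S w (c w) * (z w).2) * (z w).1⁻¹), (endoTorus L S c).2) ∂(Measure.pi Λw)) ∧
      ContDiffOn ℝ ∞ (fun c : {w : InfinitePlace L // IsComplex w} → Fin 3 → ℝ =>
        ∫ z, fH ((archPiEquivCM 2 L Φ₂[L]).symm (fun w => (z w).1 * (endoBlockAt L S w (c w) * (z w).2) * (z w).1⁻¹), (endoTorus L S c).2) ∂(Measure.pi Λw)) (InRegS S) ∧
      (∀ c : {w : InfinitePlace L // IsComplex w} → Fin 3 → ℝ, c ∈ InRegS S →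
        stOrbFamH L νH fH S c =
          (K₀ : ℂ) * (∏ w, (if w ∈ S then ((Real.exp (c w 0) : ℝ) : ℂ) else 1 - (Circle.exp (c w 2 - c w 0) : ℂ))) *
            ∑ T ∈ (Finset.univ \ S).powerset, ∫ z, fH ((archPiEquivCM 2 L Φ₂[L]).symm
              (fun w => (z w).1 * (endoBlockAt L S w (flipSet T c w) * (z w).2) * (z w).1⁻¹), (endoTorus L S (flipSet T c)).2) ∂(Measure.pi Λw)) ∧
      (∀ (p : {w : InfinitePlace L // IsComplex w} → Prop) [DecidablePred p], (∀ w, p w → w ∉ S) →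
        ∀ c : {w : InfinitePlace L // IsComplex w} → Fin 3 → ℝ, c ∈ InRegS S →
          (∫ z, fH ((archPiEquivCM 2 L Φ₂[L]).symm (fun w => (z w).1 * (endoBlockAt L S w (c w) * (z w).2) * (z w).1⁻¹), (endoTorus L S c).2) ∂(Measure.pi Λw)) =
            ∫ z' : ∀ w : {w : {w : InfinitePlace L // IsComplex w} // ¬ p w}, ↥(archLocal L 2 Φ₂[L] w.1) × ↥(archLocal L 2 Φ₂[L] w.1),
              (∫ g : ∀ w : {w : {w : InfinitePlace L // IsComplex w} // p w}, ↥(archLocal L 2 Φ₂[L] w.1),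
                fH ((archPiEquivCM 2 L Φ₂[L]).symm (fun w => if h : p w then g ⟨w, h⟩ * endoBlockAt L S w (c w) * (g ⟨w, h⟩)⁻¹
                  else (z' ⟨w, h⟩).1 * (endoBlockAt L S w (c w) * (z' ⟨w, h⟩).2) * (z' ⟨w, h⟩).1⁻¹), (endoTorus L S c).2)
                ∂(Measure.pi fun w : {w : {w : InfinitePlace L // IsComplex w} // p w} => νw w.1))
              ∂(Measure.pi fun w : {w : {w : InfinitePlace L // IsComplex w} // ¬ p w} => Λw w.1)) := by
  haveI : ∀ w : {w : InfinitePlace L // IsComplex w}, LocallyCompactSpace ↥(archLocal L 2 Φ₂[L] w) := fun w => locallyCompactSpace_archLocal_two L w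
  haveI : ∀ w : {w : InfinitePlace L // IsComplex w}, SecondCountableTopology ↥(archLocal L 2 Φ₂[L] w) := fun w => secondCountableTopology_archLocal_two L w
  obtain ⟨νw, hνH', hνR, K₀, Λw, Zw, hΛfin, hZcl, hZnull, hexpl, hprop, hid⟩ :=
    exists_placeLeaves_archRH_mul_chartOrbH_eq_of_isHaarMeasure L S νH fH hfH.continuous
  haveI : ∀ w, (νw w).IsHaarMeasure := hνH'
  haveI : ∀ w, IsFiniteMeasureOnCompacts (Λw w) := hΛfin
  have hσ : ∀ w, SigmaFinite (Λw w) := fun w => inferInstance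
  haveI := hσ
  -- (b) smoothness of `I` on `InRegS S`
  have hI : ContDiffOn ℝ ∞ (fun c : {w : InfinitePlace L // IsComplex w} → Fin 3 → ℝ =>
      ∫ z, fH ((archPiEquivCM 2 L Φ₂[L]).symm (fun w => (z w).1 * (endoBlockAt L S w (c w) * (z w).2) * (z w).1⁻¹), (endoTorus L S c).2) ∂(Measure.pi Λw)) (InRegS S) :=
    contDiffOn_piLeafIntegral_inRegS L S hfH Λw Zw hZcl hZnull hprop
  refine ⟨νw, hνH', hνR, K₀, Λw, Zw, hΛfin, hσ, hZcl, hZnull, hexpl, hprop, hid, hI, ?_, fun p _ hp c hc => ?_⟩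
  · -- (c) the model identity on `InRegS S`
    -- abbreviate `I`
    obtain ⟨I, hI_def⟩ : ∃ I : ({w : InfinitePlace L // IsComplex w} → Fin 3 → ℝ) → ℂ, I = fun c =>
        ∫ z, fH ((archPiEquivCM 2 L Φ₂[L]).symm (fun w => (z w).1 * (endoBlockAt L S w (c w) * (z w).2) * (z w).1⁻¹), (endoTorus L S c).2) ∂(Measure.pi Λw) := ⟨_, rfl⟩
    have hI' : ContDiffOn ℝ ∞ I (InRegS S) := by rw [hI_def]; exact hI
    have hid' : ∀ c : {w : InfinitePlace L // IsComplex w} → Fin 3 → ℝ, c ∈ RegS S → archRH S c * chartOrbH L νH S fH c =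
        (K₀ : ℂ) * (∏ w, (if w ∈ S then ((Real.exp (c w 0) : ℝ) : ℂ) else 1 - (Circle.exp (c w 2 - c w 0) : ℂ))) * I c := fun c hc => by
      rw [hI_def]; exact hid c hc
    have hgoal : ∀ c, c ∈ InRegS S → stOrbFamH L νH fH S c =
        (K₀ : ℂ) * (∏ w, (if w ∈ S then ((Real.exp (c w 0) : ℝ) : ℂ) else 1 - (Circle.exp (c w 2 - c w 0) : ℂ))) * ∑ T ∈ (Finset.univ \ S).powerset, I (flipSet T c) := by
      -- the smooth model `G`
      obtain ⟨G, hG_def⟩ : ∃ G : ({w : InfinitePlace L // IsComplex w} → Fin 3 → ℝ) → ℂ, G = fun c =>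
          (K₀ : ℂ) * (∏ w, (if w ∈ S then ((Real.exp (c w 0) : ℝ) : ℂ) else 1 - (Circle.exp (c w 2 - c w 0) : ℂ))) *
            ∑ T ∈ (Finset.univ \ S).powerset, I (flipSet T c) := ⟨_, rfl⟩
      have hG : ContDiffOn ℝ ∞ G (InRegS S) := by
        rw [hG_def]
        refine (contDiffOn_const.mul (contDiff_expFactor S).contDiffOn).mul (ContDiffOn.sum fun T _ => ?_)
        exact hI'.comp (contDiff_flipSet T).contDiffOn fun c hc => (flipSet_mem_inRegS_iff S T c).2 hc
      -- on `RegS S` the family IS `G`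
      have hreg : ∀ c ∈ RegS S, stOrbFamH L νH fH S c = G c := by
        intro c hc
        rw [stOrbFamH_of_mem_regS L νH fH S hc, hG_def]
        simp only
        rw [Finset.mul_sum, Finset.mul_sum]
        refine Finset.sum_congr rfl fun T hT => ?_
        have hTS : ∀ w ∈ T, w ∉ S := not_mem_of_mem_powerset_sdiff hT
        have hcT : flipSet T c ∈ RegS S := (flipSet_mem_regS_iff S hTS c).2 hc
        have hcTI : flipSet T c ∈ InRegS S := regS_subset_inRegS S hcT
        have h := hid' (flipSet T c) hcT
        rw [archRH_eq_splitFactor_mul_cptFactor, expFactor_eq_splitFactor_mul_cptFactor,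
          splitFactor_flipSet S hTS (fun x => ((|Real.exp x - Real.exp (-x)| : ℝ) : ℂ)), splitFactor_flipSet S hTS (fun x => ((Real.exp x : ℝ) : ℂ))] at h
        have hne := cptFactor_ne_zero_of_mem_inRegS S hcTI
        have h' : (∏ w, (if w ∈ S then ((|Real.exp (c w 0) - Real.exp (-c w 0)| : ℝ) : ℂ) else 1)) * chartOrbH L νH S fH (flipSet T c) =
            (K₀ : ℂ) * (∏ w, (if w ∈ S then ((Real.exp (c w 0) : ℝ) : ℂ) else 1)) * I (flipSet T c) := by
          have h2 : (∏ w, (if w ∈ S then (1 : ℂ) else 1 - (Circle.exp (flipSet T c w 2 - flipSet T c w 0) : ℂ))) *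
              ((∏ w, (if w ∈ S then ((|Real.exp (c w 0) - Real.exp (-c w 0)| : ℝ) : ℂ) else 1)) * chartOrbH L νH S fH (flipSet T c)) =
              (∏ w, (if w ∈ S then (1 : ℂ) else 1 - (Circle.exp (flipSet T c w 2 - flipSet T c w 0) : ℂ))) *
              ((K₀ : ℂ) * (∏ w, (if w ∈ S then ((Real.exp (c w 0) : ℝ) : ℂ) else 1)) * I (flipSet T c)) := by
            calc _ = (∏ w, (if w ∈ S then ((|Real.exp (c w 0) - Real.exp (-c w 0)| : ℝ) : ℂ) else 1)) *
                  (∏ w, (if w ∈ S then (1 : ℂ) else 1 - (Circle.exp (flipSet T c w 2 - flipSet T c w 0) : ℂ))) * chartOrbH L νH S fH (flipSet T c) := by ring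
              _ = _ := by rw [h]; ring
          exact mul_left_cancel₀ hne h2
        rw [archRH_eq_splitFactor_mul_cptFactor, expFactor_eq_splitFactor_mul_cptFactor]
        calc (∏ w, (if w ∈ S then ((|Real.exp (c w 0) - Real.exp (-c w 0)| : ℝ) : ℂ) else 1)) *
              (∏ w, (if w ∈ S then (1 : ℂ) else 1 - (Circle.exp (c w 2 - c w 0) : ℂ))) * chartOrbH L νH S fH (flipSet T c)
            = (∏ w, (if w ∈ S then (1 : ℂ) else 1 - (Circle.exp (c w 2 - c w 0) : ℂ))) *
              ((∏ w, (if w ∈ S then ((|Real.exp (c w 0) - Real.exp (-c w 0)| : ℝ) : ℂ) else 1)) * chartOrbH L νH S fH (flipSet T c)) := by ring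
          _ = _ := by rw [h']; ring
      -- at the real walls the family is the limit of `G` from `RegS S`
      intro c hc
      rw [show (K₀ : ℂ) * (∏ w, (if w ∈ S then ((Real.exp (c w 0) : ℝ) : ℂ) else 1 - (Circle.exp (c w 2 - c w 0) : ℂ))) *
          ∑ T ∈ (Finset.univ \ S).powerset, I (flipSet T c) = G c by rw [hG_def]]
      by_cases hcR : c ∈ RegS S
      · exact hreg c hcR
      · refine stOrbFamH_eq_of_tendsto L νH fH S hc hcR (mem_closure_regS S c) ?_
        have hcont : ContinuousAt G c := (hG.continuousOn.continuousWithinAt hc).continuousAt ((isOpen_inRegS S).mem_nhds hc)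
        refine (hcont.tendsto.mono_left nhdsWithin_le_nhds).congr' ?_
        filter_upwards [self_mem_nhdsWithin] with c' hc'
        rw [← hreg c' hc', stOrbFamH_of_mem_regS L νH fH S hc', stableSum_def]
    intro c hc
    rw [hgoal c hc, hI_def]
  · -- (d) the Fubini form on `InRegS S` (properness at the point `c`: regular at the compact places)
    have hreg : ∀ w, w ∉ S → Circle.exp (c w 0) ≠ Circle.exp (c w 2) := (mem_inRegS_iff S c).1 hc
    refine integral_unfoldIntegrand_eq_integral_integral L S fH hfH.continuous (ArchSmooth₂.hasCompactSupport L hfH) Λw Zw hZcl hZnull νw p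
      (fun w hw => hexpl w (hp w hw)) c (fun w C' hC' => ?_) (endoTorus L S c).2
    obtain ⟨𝒮, h𝒮, h⟩ := hprop w {c} isCompact_singleton (fun hw c' hc' => by rw [Set.mem_singleton_iff.1 hc']; exact hreg w hw) C' hC'
    exact ⟨𝒮, h𝒮, fun z hz hzC => h z hz c (Set.mem_singleton c) hzC⟩

end Model

end Literature.NumberTheory.Rogawski1990

end
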